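import Summits.ResolutionOfSingularities.ResolutionOfSingularities.Theses.PAlteration
import Summits.ResolutionOfSingularities.ResolutionOfSingularities.Theorems.Picover.Negative.RadicialCover
import Literature.AlgebraicGeometry.Resolution.ProjectiveSpaceRegular
import Literature.AlgebraicGeometry.Resolution.RankOneReductionProofs
import Literature.AlgebraicGeometry.Resolution.QuadraticTransformsUFD
import Literature.Barriers.ResolutionOfSingularities.QuasiExcellenceNecessaryNagataProofs
import Mathlib.FieldTheory.IntermediateField.Adjoin.Basic

/-!
# `Picover` — negative lemma: finite type over a field (excellence of the base) is load-bearing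

Support (negative) lemma for crux `stmt-ResolutionOfSingularities-0554`
(`Summit.ResolutionOfSingularities.ResolutionOfSingularities.Theses.PAlteration.Picover`: every
integral `X` finite, universally injective and surjective over a REGULAR integral separated
finite-type `k`-scheme `Y`, `char k = p`, has a resolution), filed by the standing disprover
(cdisprove gen 1; work file `Cruxes/Picover/Disproof.lean`, §2g). This file declares NO
definition; the dropped-hypothesis variant is written out inline.

* `picover_false_without_locallyOfFiniteType_at` — with `LocallyOfFiniteType f` (finite type of
  `Y → Spec k`) dropped, keeping `Y` regular, integral, affine (separated, quasi-compact) over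
  `k = 𝔽_p`, the statement is FALSE at every prime `p`. Witness: `Y = Spec S` for F. K. Schmidt's /
  Nagata's discrete valuation ring `S = K ∩ 𝔽_p⟦X⟧`, `K = 𝔽_p(X, f^p) ⊂ 𝔽_p((X))` with
  `f ∈ X𝔽_p⟦X⟧` transcendental over `𝔽_p(X)` (the tree's `Nagata1962.exists_data`), and the purely
  inseparable degree-`p` cover `X = Spec S[f] → Spec S` (`f^p ∈ S`): finite, universally injective,
  surjective, `S[f] ⊆ K(f)` a domain. A resolution of `Spec S[f]` would give, by the valuative
  criterion of properness (tree `exists_fg_regular_of_hasResolution`, packaged as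
  `exists_model_of_hasResolution_adjoin`), a finitely generated `S`-subalgebra `A ⊆ O = K(f) ∩ 𝔽_p⟦X⟧`
  with `Frac A = K(f)` regular at the centre of `O`; `schmidt_no_regular_model` shows there is none
  (all of `O` is integral over `S` by Frobenius, so `A` is finite over `S`; `A_𝔮` regular of
  dimension `≤ 1` is a valuation ring dominated by `O`, whence `O ⊆ A` and the integral closure of
  `S` in `K(f)` would be finite — contradicting Kollár's Claim 1.104, proved in the tree as
  `Nagata1962.not_finite_integralClosure_adjoin`).
  MORAL FOR PROVERS: regularity of `Y` alone cannot carry a proof of the crux; the proof must use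
  that `Y` is of finite type over a field (excellence: finiteness of normalisation in purely
  inseparable extensions / openness of the regular locus) — Grothendieck's EGA IV₂ 7.9.5
  phenomenon (barrier `Literature.Barriers.ResolutionOfSingularities.QuasiExcellence…`), here
  already for a finite flat degree-`p` cover of a regular affine curve.
* The generic ingredients (the cover `Spec S[y] → Spec S`, `y^p ∈ S`, is finite, surjective and
  universally injective; resolution of `Spec S[t]` ⇒ local uniformization of `Frac S[t]`) are in
  `RadicialCover.lean` (same directory).

## Sources
* J. Kollár, *Lectures on Resolution of Singularities*, Ann. of Math. Stud. 166 (2007), §1.13,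
  Example 1.103 and Claim 1.104 (after Nagata, *Local Rings*, App. Ex. 3; here with F. K. Schmidt's
  ring). [Kollar2007]
* A. Grothendieck, EGA IV₂ (7.9.5) (resolution forces quasi-excellence).
* The Stacks Project, Tag 01S4 (universally injective morphisms).
* O. Zariski, Ann. of Math. 41 (1940) (resolution ⇒ local uniformization, via the valuative
  criterion; tree `ResolutionLU.lean`).
-/

noncomputable section

open CategoryTheory AlgebraicGeometry TopologicalSpace IsLocalRing
open Literature.AlgebraicGeometry.Resolution
open Literature.Barriers.ResolutionOfSingularities.QuasiExcellence

set_option linter.dupNamespace false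

namespace Summit.ResolutionOfSingularities.ResolutionOfSingularities.Theorems.Picover.Negative

/-! ### F. K. Schmidt's / Nagata's discrete valuation ring: no regular finitely generated model -/

section Schmidt

open scoped LaurentSeries PowerSeries IntermediateField

variable (p : ℕ) [hp : Fact p.Prime]

set_option maxHeartbeats 1600000 in
set_option synthInstance.maxHeartbeats 200000 in
/-- **Schmidt–Nagata: no finitely generated regular model.** For the tree's data
(`Nagata1962.exists_data`: `X ∈ K`, `f ^ p ∈ K`, `f ∉ K`, `|f| < 1`), with `S = K ∩ 𝔽_p⟦X⟧`,
`F = K(f)`, `O = F ∩ 𝔽_p⟦X⟧`, `t = f`: NO finitely generated `S`-subalgebra `A` of `F` inside `O`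
with `Frac A = F` is regular at the centre of `O`. (Every element of `O` is integral over `S` by
Frobenius, so `A` is finite over `S`; `A_𝔮` regular of dimension `≤ 1` is a valuation ring, so
`O ⊆ A_𝔮 ⊆ A`-with-units-inverted `= A`; then the integral closure of `S` in `F` would be finite,
contradicting `Nagata1962.not_finite_integralClosure_adjoin`.) Proof adapted from the crux work file
`Cruxes/LuAlphaPTorsor/Disproof.lean`, `not_torsorOverDVR`.
[cite: Kollar2007, Example 1.103 and Claim 1.104] -/
theorem schmidt_no_regular_model (f : (ZMod p)⟦X⟧) (K : IntermediateField (ZMod p) (ZMod p)⸨X⸩)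
    (ht : (HahnSeries.single 1 1 : (ZMod p)⸨X⸩) ∈ K) (hzp : ((f : (ZMod p)⸨X⸩) ^ p ∈ K))
    (hz : (f : (ZMod p)⸨X⸩) ∉ K)
    [Algebra (Valued.v.comap (algebraMap K (ZMod p)⸨X⸩)).valuationSubring (↥K⟮(f : (ZMod p)⸨X⸩)⟯)] [IsScalarTower (Valued.v.comap (algebraMap K (ZMod p)⸨X⸩)).valuationSubring K (↥K⟮(f : (ZMod p)⸨X⸩)⟯)]
    (A : Subalgebra (Valued.v.comap (algebraMap K (ZMod p)⸨X⸩)).valuationSubring (↥K⟮(f : (ZMod p)⸨X⸩)⟯))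
    (hAO : A.toSubring ≤ (Valued.v.comap (algebraMap (↥K⟮(f : (ZMod p)⸨X⸩)⟯) (ZMod p)⸨X⸩)).valuationSubring.toSubring) (hAfg : A.FG)
    (hAfr : IsFractionRing A (↥K⟮(f : (ZMod p)⸨X⸩)⟯)) :
    ¬ IsRegularLocalRing (Localization.AtPrime (Ideal.comap (Subring.inclusion hAO)
        (IsLocalRing.maximalIdeal (Valued.v.comap (algebraMap (↥K⟮(f : (ZMod p)⸨X⸩)⟯) (ZMod p)⸨X⸩)).valuationSubring))) := by
  classical
  intro hreg
  letI : Module (Valued.v.comap (algebraMap K (ZMod p)⸨X⸩)).valuationSubring (↥K⟮(f : (ZMod p)⸨X⸩)⟯) := Algebra.toModule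
  haveI := Nagata1962.isDiscreteValuationRing p K ht
  haveI : CharP (Valued.v.comap (algebraMap K (ZMod p)⸨X⸩)).valuationSubring p := Nagata1962.charP_valuationSubring p K
  haveI : CharP (ZMod p)⸨X⸩ p := SchmidtDefect.charP_laurentSeries p
  have hinj : Function.Injective (algebraMap (Valued.v.comap (algebraMap K (ZMod p)⸨X⸩)).valuationSubring (↥K⟮(f : (ZMod p)⸨X⸩)⟯)) := by
    rw [IsScalarTower.algebraMap_eq (Valued.v.comap (algebraMap K (ZMod p)⸨X⸩)).valuationSubring K (↥K⟮(f : (ZMod p)⸨X⸩)⟯)]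
    exact (algebraMap K (↥K⟮(f : (ZMod p)⸨X⸩)⟯)).injective.comp Subtype.val_injective
  have hcoe : ∀ s : (Valued.v.comap (algebraMap K (ZMod p)⸨X⸩)).valuationSubring, ((algebraMap (Valued.v.comap (algebraMap K (ZMod p)⸨X⸩)).valuationSubring (↥K⟮(f : (ZMod p)⸨X⸩)⟯) s :
      (↥K⟮(f : (ZMod p)⸨X⸩)⟯)) : (ZMod p)⸨X⸩) = ((s : K) : (ZMod p)⸨X⸩) := fun s => by
    rw [IsScalarTower.algebraMap_apply (Valued.v.comap (algebraMap K (ZMod p)⸨X⸩)).valuationSubring K (↥K⟮(f : (ZMod p)⸨X⸩)⟯)]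
    rfl
  -- membership in `O` / value `< 1` is read off in `𝔽_p((X))`
  have hmemO : ∀ y : (↥K⟮(f : (ZMod p)⸨X⸩)⟯), y ∈ (Valued.v.comap (algebraMap (↥K⟮(f : (ZMod p)⸨X⸩)⟯) (ZMod p)⸨X⸩)).valuationSubring ↔ Valued.v (y : (ZMod p)⸨X⸩) ≤ 1 :=
    fun y => by rw [Valuation.mem_valuationSubring_iff]; rfl
  have hSO : ∀ s : (Valued.v.comap (algebraMap K (ZMod p)⸨X⸩)).valuationSubring, algebraMap (Valued.v.comap (algebraMap K (ZMod p)⸨X⸩)).valuationSubring (↥K⟮(f : (ZMod p)⸨X⸩)⟯) s ∈ (Valued.v.comap (algebraMap (↥K⟮(f : (ZMod p)⸨X⸩)⟯) (ZMod p)⸨X⸩)).valuationSubring :=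
    fun s => by
    rw [hmemO, hcoe]
    exact (Valuation.mem_valuationSubring_iff _ _).mp s.2
  -- (1) every element of `O` is integral over `S`: Frobenius puts `y ^ p` in `K`, and `|y^p| ≤ 1`
  have hfrob : ∀ y : (ZMod p)⸨X⸩, y ∈ Algebra.adjoin K ({(f : (ZMod p)⸨X⸩)} : Set (ZMod p)⸨X⸩) →
      ∃ c : K, (c : (ZMod p)⸨X⸩) = y ^ p := by
    intro y hy
    induction hy using Algebra.adjoin_induction with
    | mem x hx =>
      rw [Set.mem_singleton_iff] at hx
      subst hx
      exact ⟨⟨_, hzp⟩, rfl⟩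
    | algebraMap c => exact ⟨c ^ p, by simp⟩
    | add x y _ _ hx hy =>
      obtain ⟨cx, hcx⟩ := hx
      obtain ⟨cy, hcy⟩ := hy
      exact ⟨cx + cy, by rw [add_pow_char, ← hcx, ← hcy]; rfl⟩
    | mul x y _ _ hx hy =>
      obtain ⟨cx, hcx⟩ := hx
      obtain ⟨cy, hcy⟩ := hy
      exact ⟨cx * cy, by rw [mul_pow, ← hcx, ← hcy]; rfl⟩
  have hOint : ∀ y : (↥K⟮(f : (ZMod p)⸨X⸩)⟯), y ∈ (Valued.v.comap (algebraMap (↥K⟮(f : (ZMod p)⸨X⸩)⟯) (ZMod p)⸨X⸩)).valuationSubring → IsIntegral (Valued.v.comap (algebraMap K (ZMod p)⸨X⸩)).valuationSubring y := by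
    intro y hy
    have hy' : (y : (ZMod p)⸨X⸩) ∈ Algebra.adjoin K ({(f : (ZMod p)⸨X⸩)} : Set (ZMod p)⸨X⸩) := by
      rw [← IntermediateField.adjoin_simple_toSubalgebra_of_isAlgebraic
        (SchmidtDefect.isIntegral_gen p K (f : (ZMod p)⸨X⸩) hzp).isAlgebraic]
      exact y.2
    obtain ⟨c, hc⟩ := hfrob _ hy'
    have hcS : c ∈ (Valued.v.comap (algebraMap K (ZMod p)⸨X⸩)).valuationSubring := by
      rw [Valuation.mem_valuationSubring_iff]
      change Valued.v (c : (ZMod p)⸨X⸩) ≤ 1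
      rw [hc, Valuation.map_pow]
      exact pow_le_one₀ zero_le ((hmemO y).mp hy)
    refine Nagata1962.isIntegral_of_pow_eq hp.out.ne_zero (s := ⟨c, hcS⟩) ?_
    apply Subtype.ext
    change ((y : (ZMod p)⸨X⸩)) ^ p = ((algebraMap (Valued.v.comap (algebraMap K (ZMod p)⸨X⸩)).valuationSubring (↥K⟮(f : (ZMod p)⸨X⸩)⟯) ⟨c, hcS⟩ :
      (↥K⟮(f : (ZMod p)⸨X⸩)⟯)) : (ZMod p)⸨X⸩)
    rw [hcoe]
    change ((y : (ZMod p)⸨X⸩)) ^ p = (c : (ZMod p)⸨X⸩)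
    rw [hc]
  -- (2) hence `A` is integral and FINITE over `S`
  haveI : Algebra.IsIntegral (Valued.v.comap (algebraMap K (ZMod p)⸨X⸩)).valuationSubring A := ⟨fun a =>
    (isIntegral_algHom_iff A.val Subtype.val_injective).mp (hOint _ (hAO a.2))⟩
  haveI : Algebra.FiniteType (Valued.v.comap (algebraMap K (ZMod p)⸨X⸩)).valuationSubring A := A.fg_iff_finiteType.mp hAfg
  haveI : Module.Finite (Valued.v.comap (algebraMap K (ZMod p)⸨X⸩)).valuationSubring A := Algebra.IsIntegral.finite
  -- (3) the local ring `Λ = A_𝔮 ⊆ F` at the centre: regular of dimension `≤ 1`, hence a PID,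
  --     hence a valuation ring
  haveI : IsFractionRing A.toSubring (↥K⟮(f : (ZMod p)⸨X⸩)⟯) := hAfr
  set 𝔮 : Ideal A.toSubring := (maximalIdeal (Valued.v.comap (algebraMap (↥K⟮(f : (ZMod p)⸨X⸩)⟯) (ZMod p)⸨X⸩)).valuationSubring).comap (Subring.inclusion hAO)
    with h𝔮
  let Λ : Subalgebra A.toSubring (↥K⟮(f : (ZMod p)⸨X⸩)⟯) := Localization.subalgebra.ofField
    (↥K⟮(f : (ZMod p)⸨X⸩)⟯) 𝔮.primeCompl (Ideal.primeCompl_le_nonZeroDivisors _)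
  haveI hregΛ : IsRegularLocalRing Λ :=
    (isRegularLocalRing_iff_centreLocalization (Valued.v.comap (algebraMap (↥K⟮(f : (ZMod p)⸨X⸩)⟯) (ZMod p)⸨X⸩)).valuationSubring A hAO).mp hreg
  have hdimA : ringKrullDim A.toSubring = 1 :=
    Nagata1962.ringKrullDim_subalgebra_eq_one (S := (Valued.v.comap (algebraMap K (ZMod p)⸨X⸩)).valuationSubring) A hinj
  have hdimΛ : ringKrullDim Λ ≤ 1 := by
    rw [IsLocalization.AtPrime.ringKrullDim_eq_height 𝔮 Λ, ← hdimA]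
    exact Ideal.height_le_ringKrullDim_of_isPrime
  haveI : IsPrincipalIdealRing Λ := isPrincipalIdealRing_of_ringKrullDim_le_one hdimΛ
  haveI : ValuationRing Λ := inferInstance
  -- (4) `O ⊆ Λ`: `Λ` is a valuation ring of `F` dominated by `O`
  have hOΛ : ∀ x : (↥K⟮(f : (ZMod p)⸨X⸩)⟯), x ∈ (Valued.v.comap (algebraMap (↥K⟮(f : (ZMod p)⸨X⸩)⟯) (ZMod p)⸨X⸩)).valuationSubring → x ∈ Λ := by
    intro x hxO
    rcases ValuationRing.isInteger_or_isInteger Λ x with ⟨y, hy⟩ | ⟨y, hy⟩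
    · rw [← hy]; exact y.2
    · by_cases hx0 : x = 0
      · rw [hx0]; exact Λ.zero_mem
      have hy' : x⁻¹ ∈ Λ := by rw [← hy]; exact y.2
      rw [mem_centreLocalization_iff] at hy' ⊢
      obtain ⟨a, ha, s, hs, hs1, hxinv⟩ := hy'
      have ha1 : (Valued.v.comap (algebraMap (↥K⟮(f : (ZMod p)⸨X⸩)⟯) (ZMod p)⸨X⸩)).valuationSubring.valuation a = 1 := by
        apply le_antisymm (((Valued.v.comap (algebraMap (↥K⟮(f : (ZMod p)⸨X⸩)⟯) (ZMod p)⸨X⸩)).valuationSubring.valuation_le_one_iff a).mpr (hAO ha))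
        have hx1 : (Valued.v.comap (algebraMap (↥K⟮(f : (ZMod p)⸨X⸩)⟯) (ZMod p)⸨X⸩)).valuationSubring.valuation x ≤ 1 :=
          ((Valued.v.comap (algebraMap (↥K⟮(f : (ZMod p)⸨X⸩)⟯) (ZMod p)⸨X⸩)).valuationSubring.valuation_le_one_iff x).mpr hxO
        have hvx0 : (Valued.v.comap (algebraMap (↥K⟮(f : (ZMod p)⸨X⸩)⟯) (ZMod p)⸨X⸩)).valuationSubring.valuation x ≠ 0 := by rwa [Ne, Valuation.zero_iff]
        have : (Valued.v.comap (algebraMap (↥K⟮(f : (ZMod p)⸨X⸩)⟯) (ZMod p)⸨X⸩)).valuationSubring.valuation x⁻¹ = (Valued.v.comap (algebraMap (↥K⟮(f : (ZMod p)⸨X⸩)⟯) (ZMod p)⸨X⸩)).valuationSubring.valuation a := by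
          rw [hxinv, map_mul, map_inv₀, hs1, inv_one, mul_one]
        rw [← this, map_inv₀]
        exact (one_le_inv₀ (zero_lt_iff.mpr hvx0)).mpr hx1
      refine ⟨s, hs, a, ha, ha1, ?_⟩
      rw [← inv_inv x, hxinv, mul_inv, inv_inv, mul_comm]
  -- (5) units: `s ∈ A`, `v(s) = 1` ⇒ `s⁻¹ ∈ A` (integral over `S ⊆ A`), so `Λ ⊆ A`
  have hunit : ∀ s : (↥K⟮(f : (ZMod p)⸨X⸩)⟯), s ∈ A → (Valued.v.comap (algebraMap (↥K⟮(f : (ZMod p)⸨X⸩)⟯) (ZMod p)⸨X⸩)).valuationSubring.valuation s = 1 → s⁻¹ ∈ A := by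
    intro s hs hs1
    have hsinvO : s⁻¹ ∈ (Valued.v.comap (algebraMap (↥K⟮(f : (ZMod p)⸨X⸩)⟯) (ZMod p)⸨X⸩)).valuationSubring := by
      rw [← (Valued.v.comap (algebraMap (↥K⟮(f : (ZMod p)⸨X⸩)⟯) (ZMod p)⸨X⸩)).valuationSubring.valuation_le_one_iff, map_inv₀, hs1, inv_one]
    have hint : IsIntegral A.toSubring s⁻¹ := (hOint _ hsinvO).tower_top (A := A)
    exact inv_mem_of_isIntegral_inv (A := A.toSubring) hs hint
  have hΛA : ∀ x : (↥K⟮(f : (ZMod p)⸨X⸩)⟯), x ∈ Λ → x ∈ A := by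
    intro x hx
    rw [mem_centreLocalization_iff] at hx
    obtain ⟨a, ha, s, hs, hs1, rfl⟩ := hx
    exact A.mul_mem ha (hunit s hs hs1)
  -- (6) the integral closure of `S` in `F` lies in `A`, hence is finite over `S`: contradiction
  have hTA : integralClosure (Valued.v.comap (algebraMap K (ZMod p)⸨X⸩)).valuationSubring (↥K⟮(f : (ZMod p)⸨X⸩)⟯) ≤ A := by
    intro y hy
    refine hΛA y (hOΛ y ?_)
    letI : Algebra (Valued.v.comap (algebraMap K (ZMod p)⸨X⸩)).valuationSubring (Valued.v.comap (algebraMap (↥K⟮(f : (ZMod p)⸨X⸩)⟯) (ZMod p)⸨X⸩)).valuationSubring :=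
      ((algebraMap (Valued.v.comap (algebraMap K (ZMod p)⸨X⸩)).valuationSubring (↥K⟮(f : (ZMod p)⸨X⸩)⟯)).codRestrict (Valued.v.comap (algebraMap (↥K⟮(f : (ZMod p)⸨X⸩)⟯) (ZMod p)⸨X⸩)).valuationSubring.toSubring
        fun s => hSO s).toAlgebra
    haveI : IsScalarTower (Valued.v.comap (algebraMap K (ZMod p)⸨X⸩)).valuationSubring (Valued.v.comap (algebraMap (↥K⟮(f : (ZMod p)⸨X⸩)⟯) (ZMod p)⸨X⸩)).valuationSubring (↥K⟮(f : (ZMod p)⸨X⸩)⟯) :=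
      IsScalarTower.of_algebraMap_eq fun _ => rfl
    have hint : IsIntegral (Valued.v.comap (algebraMap (↥K⟮(f : (ZMod p)⸨X⸩)⟯) (ZMod p)⸨X⸩)).valuationSubring y := ((mem_integralClosure_iff _ _).1 hy).tower_top
    exact (Valuation.valuationSubring.integers
      (Valued.v.comap (algebraMap (↥K⟮(f : (ZMod p)⸨X⸩)⟯) (ZMod p)⸨X⸩))).mem_of_integral hint
  haveI : IsNoetherian (Valued.v.comap (algebraMap K (ZMod p)⸨X⸩)).valuationSubring (Subalgebra.toSubmodule A) :=
    isNoetherian_of_isNoetherianRing_of_finite (Valued.v.comap (algebraMap K (ZMod p)⸨X⸩)).valuationSubring _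
  have hfin : Module.Finite (Valued.v.comap (algebraMap K (ZMod p)⸨X⸩)).valuationSubring
      (Subalgebra.toSubmodule (integralClosure (Valued.v.comap (algebraMap K (ZMod p)⸨X⸩)).valuationSubring (↥K⟮(f : (ZMod p)⸨X⸩)⟯))) :=
    Module.Finite.of_injective (Submodule.inclusion (Subalgebra.toSubmodule.le_iff_le.mpr hTA))
      (Submodule.inclusion_injective _)
  exact Nagata1962.not_finite_integralClosure_adjoin p K f ht hzp hz hfin

set_option maxHeartbeats 1600000 in
set_option synthInstance.maxHeartbeats 200000 in
/-- **Finite type over a field (excellence of the base) is load-bearing — the crux is FALSE over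
an arbitrary regular base, at every prime `p`.** Witness: `Y = Spec S` for F. K. Schmidt's /
Nagata's discrete valuation ring `S = K ∩ 𝔽_p⟦X⟧`, `K = 𝔽_p(X, f^p)` (`f ∈ X𝔽_p⟦X⟧`
transcendental over `𝔽_p(X)`; tree `Nagata1962.exists_data`) — regular, integral, affine over
`𝔽_p` — and `X = Spec S[f] → Y`, which is FINITE (`f^p ∈ S`), UNIVERSALLY INJECTIVE (purely
inseparable: `universallyInjective_Spec_adjoin_of_pow_eq`) and SURJECTIVE with `S[f] ⊆ K(f)`
integral. If `Spec S[f]` had a resolution, the valuative criterion would give a finitely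
generated regular model of `K(f)` along `O = K(f) ∩ 𝔽_p⟦X⟧` (`exists_model_of_hasResolution_adjoin`),
which `schmidt_no_regular_model` rules out (the integral closure of `S` in `K(f)` is not finite:
Kollár, *Lectures on Resolution*, Ex. 1.103 / Claim 1.104, proved in the tree). So a proof of the
crux must use that `Y` is of finite type over a FIELD (excellence: Japanese-ness / finiteness of
normalisation in purely inseparable extensions), not merely that `Y` is regular — the phenomenon
of EGA IV₂ 7.9.5 (barrier `QuasiExcellenceNecessary`), already in relative dimension zero over a
one-dimensional base. [cite: Kollar2007, Example 1.103 and Claim 1.104] -/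
theorem picover_false_without_locallyOfFiniteType_at (p : ℕ) [hp : Fact p.Prime] :
    ¬ ∀ (k : Type) [Field k] [CharP k p] (Y X : Scheme.{0}) (f : Y ⟶ Spec (.of k)) (g : X ⟶ Y),
        IsSeparated f → QuasiCompact f → IsIntegral Y →
        Scheme.IsRegular Y → IsIntegral X → IsFinite g → UniversallyInjective g →
        Function.Surjective g.base → Scheme.HasResolution X := by
  classical
  intro H
  obtain ⟨f, K, ht, hzp, hz, hvz⟩ := Nagata1962.exists_data p
  letI : Algebra (Valued.v.comap (algebraMap K (ZMod p)⸨X⸩)).valuationSubring (↥K⟮(f : (ZMod p)⸨X⸩)⟯) :=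
    ((algebraMap K (↥K⟮(f : (ZMod p)⸨X⸩)⟯)).comp (algebraMap (Valued.v.comap (algebraMap K (ZMod p)⸨X⸩)).valuationSubring K)).toAlgebra
  haveI : IsScalarTower (Valued.v.comap (algebraMap K (ZMod p)⸨X⸩)).valuationSubring K (↥K⟮(f : (ZMod p)⸨X⸩)⟯) :=
    IsScalarTower.of_algebraMap_eq fun _ => rfl
  haveI := Nagata1962.isDiscreteValuationRing p K ht
  haveI : CharP (Valued.v.comap (algebraMap K (ZMod p)⸨X⸩)).valuationSubring p := Nagata1962.charP_valuationSubring p K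
  haveI : CharP (ZMod p)⸨X⸩ p := SchmidtDefect.charP_laurentSeries p
  haveI : CharP (↥K⟮(f : (ZMod p)⸨X⸩)⟯) p := Nagata1962.charP_adjoin p K f
  have hinj : Function.Injective (algebraMap (Valued.v.comap (algebraMap K (ZMod p)⸨X⸩)).valuationSubring (↥K⟮(f : (ZMod p)⸨X⸩)⟯)) :=
    (algebraMap K (↥K⟮(f : (ZMod p)⸨X⸩)⟯)).injective.comp Subtype.val_injective
  -- `t = f ∈ F`, `t ^ p ∈ S`
  set t : (↥K⟮(f : (ZMod p)⸨X⸩)⟯) := IntermediateField.AdjoinSimple.gen K (f : (ZMod p)⸨X⸩) with htdef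
  have htp : t ^ p = algebraMap (Valued.v.comap (algebraMap K (ZMod p)⸨X⸩)).valuationSubring (↥K⟮(f : (ZMod p)⸨X⸩)⟯)
      ⟨⟨(f : (ZMod p)⸨X⸩) ^ p, hzp⟩, Nagata1962.pow_p_mem p K f hzp hvz⟩ := by
    rw [IsScalarTower.algebraMap_apply (Valued.v.comap (algebraMap K (ZMod p)⸨X⸩)).valuationSubring K (↥K⟮(f : (ZMod p)⸨X⸩)⟯)]
    exact Nagata1962.gen_pow_eq p K f hzp
  have htint : IsIntegral (Valued.v.comap (algebraMap K (ZMod p)⸨X⸩)).valuationSubring t := Nagata1962.isIntegral_of_pow_eq hp.out.ne_zero htp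
  set R := Algebra.adjoin (Valued.v.comap (algebraMap K (ZMod p)⸨X⸩)).valuationSubring ({t} : Set (↥K⟮(f : (ZMod p)⸨X⸩)⟯)) with hRdef
  have hfrR : IsFractionRing R (↥K⟮(f : (ZMod p)⸨X⸩)⟯) := by
    refine Nagata1962.isFractionRing_subalgebra (S := (Valued.v.comap (algebraMap K (ZMod p)⸨X⸩)).valuationSubring) (K := K)
      (IntermediateField.adjoin.powerBasis
        (SchmidtDefect.isIntegral_gen p K (f : (ZMod p)⸨X⸩) hzp)) R ?_
    rw [IntermediateField.adjoin.powerBasis_gen]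
    exact Algebra.self_mem_adjoin_singleton _ _
  -- `S ⊆ O`, `t ∈ O`
  have hmemO : ∀ y : (↥K⟮(f : (ZMod p)⸨X⸩)⟯), y ∈ (Valued.v.comap (algebraMap (↥K⟮(f : (ZMod p)⸨X⸩)⟯) (ZMod p)⸨X⸩)).valuationSubring ↔ Valued.v (y : (ZMod p)⸨X⸩) ≤ 1 :=
    fun y => by rw [Valuation.mem_valuationSubring_iff]; rfl
  have hSO : ∀ s : (Valued.v.comap (algebraMap K (ZMod p)⸨X⸩)).valuationSubring, algebraMap (Valued.v.comap (algebraMap K (ZMod p)⸨X⸩)).valuationSubring (↥K⟮(f : (ZMod p)⸨X⸩)⟯) s ∈ (Valued.v.comap (algebraMap (↥K⟮(f : (ZMod p)⸨X⸩)⟯) (ZMod p)⸨X⸩)).valuationSubring :=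
    fun s => by
    rw [hmemO]
    exact (Valuation.mem_valuationSubring_iff _ _).mp s.2
  have htO : t ∈ (Valued.v.comap (algebraMap (↥K⟮(f : (ZMod p)⸨X⸩)⟯) (ZMod p)⸨X⸩)).valuationSubring := by
    rw [hmemO]
    exact hvz.le
  -- the cover `Spec S[t] → Spec S → Spec 𝔽_p`
  let Yb : Scheme.{0} := Spec (.of (Valued.v.comap (algebraMap K (ZMod p)⸨X⸩)).valuationSubring)
  let Xs : Scheme.{0} := Spec (.of R)
  let fS : Yb ⟶ Spec (.of (ZMod p)) :=
    Spec.map (CommRingCat.ofHom (ZMod.castHom (dvd_refl p) (Valued.v.comap (algebraMap K (ZMod p)⸨X⸩)).valuationSubring))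
  let g : Xs ⟶ Yb := Spec.map (CommRingCat.ofHom (algebraMap (Valued.v.comap (algebraMap K (ZMod p)⸨X⸩)).valuationSubring R))
  have hreg : Scheme.IsRegular Yb := Scheme.isRegular_Spec (.of (Valued.v.comap (algebraMap K (ZMod p)⸨X⸩)).valuationSubring)
  haveI : IsFinite g := isFinite_Spec_adjoin htint
  haveI : UniversallyInjective g := universallyInjective_Spec_adjoin_of_pow_eq p htp
  have hsurj : Function.Surjective g.base := surjective_Spec_adjoin htint hinj
  have hres : Scheme.HasResolution Xs :=
    H (ZMod p) Yb Xs fS g inferInstance inferInstance inferInstance hreg inferInstance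
      inferInstance inferInstance hsurj
  obtain ⟨A, hAO, -, hAfg, hAfr, hregA⟩ :=
    exists_model_of_hasResolution_adjoin (Valued.v.comap (algebraMap (↥K⟮(f : (ZMod p)⸨X⸩)⟯) (ZMod p)⸨X⸩)).valuationSubring t hSO htO hfrR hres
  exact schmidt_no_regular_model p f K ht hzp hz A hAO hAfg hAfr hregA

/-- The `∀ p` form: `Picover` with `LocallyOfFiniteType f` deleted from its hypotheses is false
(instantiate `picover_false_without_locallyOfFiniteType_at` at `p = 2`). [folklore] -/
theorem picover_false_without_locallyOfFiniteType :
    ¬ ∀ p : ℕ, p.Prime → ∀ (k : Type) [Field k] [CharP k p] (Y X : Scheme.{0})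
        (f : Y ⟶ Spec (.of k)) (g : X ⟶ Y),
        IsSeparated f → QuasiCompact f → IsIntegral Y →
        Scheme.IsRegular Y → IsIntegral X → IsFinite g → UniversallyInjective g →
        Function.Surjective g.base → Scheme.HasResolution X :=
  fun h => haveI : Fact (Nat.Prime 2) := ⟨Nat.prime_two⟩
    picover_false_without_locallyOfFiniteType_at 2 (h 2 Nat.prime_two)

end Schmidt

end Summit.ResolutionOfSingularities.ResolutionOfSingularities.Theorems.Picover.Negative

end
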